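import Summits.Ventures.YMGap.RobustBall.RobustMassGapDoor
import Summits.Ventures.YMGap.Thresholds.OneLinkTiltStability
import HarnessLib

/-!
# Venture YMGap — ROBUST-BALL (Y2): the robust `ℤ^d` single-link door from an ARBITRARY one-link
# Kantorovich–Rubinstein modulus (the "quarter door" of `SU(2)`), uniform in the loads

HONEST FRAMING: venture file (cell `pub-ymgap`, seat ds-4), strong-coupling LATTICE bookkeeping for perturbed
`SU(N)` lattice gauge theory on `ℤ^d` (rb-p1's `perturbedYM`); nothing about the continuum or a Clay-sense mass gap.

WHAT.  rb-p1's `RobustMassGapDoor.isKRContraction_perturbedYM_SU` feeds the robust Dobrushin door with a one-link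
POINCARÉ/VARIANCE pair `(c, v)` (Holley–Stroock route, `ℓ_s`-free).  THIS FILE is its twin fed by ANY one-link
Kantorovich–Rubinstein modulus `OneLinkKRModulus N b K` (black-box route, `OneLinkTiltStability.su_oneLink_robust_influence`):

  `isKRContraction_perturbedYM_of_oneLinkKRModulus`:
  `IsKRContraction (perturbedYM (fundamentalRep (Fin N)) (N β) W supp) suFrobDist (perturbedNbr supp) C`,
  `C(e, y) = K e^{a} (1 + 2√N ℓ_s) |β| n(e, y) + √N ℓ(e, y)`,

with `a` the oscillation load, `ℓ_s` the SELF-Lipschitz load `Σ_{X ∈ supp{e}, e ∈ X} lip X e` (needed on this route only)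
and `ℓ(e,y)` the cross-Lipschitz witnesses, all uniform in the member; row sums
`ρ_KR = 6(d−1)|β| K e^{a}(1 + 2√N ℓ_s) + √N Λ` (`sum_perturbedNbr_coeffKR_le`); and the two consumers at `ρ_KR < 1`:
`subsingleton_perturbedGibbsMeasures_of_oneLinkKRModulus` (DLR uniqueness of the member) — the clustering twin of
rb-p1's `perturbed_covariance_decay_SU` follows the same way from the tree's `abs_covariance_le_of_isKRContraction` and is
left to the rows file.  WHY: for `SU(2)` the quarter modulus `K = 1` on `‖B‖_op ≤ 3β_W/2 ≤ 1`
(`QuarterModulusTwoThirds`) beats `√(cv) = √(4/3)` at small loads — rb-ref RB-11 / HEADLINE-CANDIDATES row 1c: `(β_W, ε) =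
(1/8, 13/100)` on this door versus `97/1000` on the hypothesis-free variance door.
-/

noncomputable section

open MeasureTheory Filter Function ProbabilityTheory Real
open scoped NNReal
open Literature.Probability.LatticeModels
open Literature.Probability.LatticeModels.DobrushinMetric
open Literature.MathematicalPhysics.QuantumLattice
open Literature.MathematicalPhysics.QuantumFieldTheory hiding ZdEdge
open Literature.MathematicalPhysics.QuantumFieldTheory.Balaban1983to89.StrongCouplingDobrushinWindow (OneLinkKRModulus)
open Summit.Ventures.YMGap.OneLinkTiltStability

namespace Summit.Ventures.YMGap.RobustBall

variable {d N : ℕ}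

section OneLinkLoads

variable {W : Potential (ZdEdge d) (Matrix.specialUnitaryGroup (Fin N) ℂ)}
  {supp : Finset (ZdEdge d) → Finset (Finset (ZdEdge d))}

/-- **Self-Lipschitz bound of the one-link perturbation**: if `|W_X(U) − W_X(U')| ≤ lip X z ‖U_z − U'_z‖_F` whenever
`U = U'` off `z`, then `|V_ω(g) − V_ω(g')| ≤ (∑_{X ∈ supp{e}, e ∈ X} lip X e) ‖g − g'‖_F` for the one-link perturbation
`V_ω(g) = H^W_{e}(ω^{e←g})`. [folklore] -/
theorem abs_hamiltonianIn_singleton_update_sub_update_le {lip : Finset (ZdEdge d) → ZdEdge d → ℝ}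
    (hlip : ∀ X, IsLipBound suFrobDist (W X) (lip X)) (e : ZdEdge d)
    (ω : LGConfig d (Matrix.specialUnitaryGroup (Fin N) ℂ)) (g g' : Matrix.specialUnitaryGroup (Fin N) ℂ) :
    |hamiltonianIn W supp {e} (Function.update ω e g) - hamiltonianIn W supp {e} (Function.update ω e g')| ≤
      (∑ X ∈ (supp {e}).filter (fun X => e ∈ X), lip X e) * suFrobDist g g' := by
  classical
  unfold hamiltonianIn
  rw [filter_inter_singleton_eq, ← Finset.sum_sub_distrib, Finset.sum_mul]
  refine (Finset.abs_sum_le_sum_abs _ _).trans (Finset.sum_le_sum fun X _ => ?_)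
  have h := (hlip X).le e (Function.update ω e g) (Function.update ω e g') fun z hz => by
    rw [Function.update_of_ne hz, Function.update_of_ne hz]
  rwa [Function.update_self, Function.update_self] at h

end OneLinkLoads

section Door

/-- **Dobrushin's condition (Vasserstein form) for the perturbed `SU(N)` specification from an ARBITRARY one-link
Kantorovich–Rubinstein modulus, UNIFORM IN THE LOADS.**  Let `d ≥ 1`, `N ≥ 1`, `β` a 't Hooft coupling, `b ≥ 2(d−1)|β|`,
`OneLinkKRModulus N b K` with `K ≥ 0`; let `W` be an adapted link potential supported by `supp`, with per-link oscillation
witnesses `osc` of total load `≤ a` through every link, per-link Lipschitz witnesses `lip`, and SELF-Lipschitz load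
`Σ_{X ∈ supp{e}, e ∈ X} lip X e ≤ ℓ_s` at every link.  Then `perturbedYM (fundamentalRep (Fin N)) (N β) W supp` is a
Kantorovich–Rubinstein contraction for the Frobenius weight over `perturbedNbr supp` with
`C(e, y) = K e^{a} (1 + 2√N ℓ_s) |β| n(e, y) + √N ℓ(e, y)`, `ℓ(e, y) = Σ_{X ∈ supp{e}, e ∈ X} lip X y` —
`OneLinkTiltStability.su_oneLink_robust_influence` at the staple fields `B_ω, B_η` and the one-link perturbations
`V_ω, V_η`. [folklore] -/
theorem isKRContraction_perturbedYM_of_oneLinkKRModulus (hd : 1 ≤ d) (hN : 1 ≤ N) {β b K a ℓs : ℝ}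
    (hK : 0 ≤ K) (hℓs : 0 ≤ ℓs) (hb : |β| * (2 * ((d : ℝ) - 1)) ≤ b) (hmod : OneLinkKRModulus N b K)
    {W : Potential (ZdEdge d) (Matrix.specialUnitaryGroup (Fin N) ℂ)} (hW : W.IsAdapted)
    {supp : Finset (ZdEdge d) → Finset (Finset (ZdEdge d))}
    {osc : Finset (ZdEdge d) → ZdEdge d → ℝ} (hosc : ∀ X, Dobrushin.IsOscBound (W X) (osc X))
    (hosca : ∀ e, ∑ X ∈ (supp {e}).filter (fun X => e ∈ X), osc X e ≤ a)
    {lip : Finset (ZdEdge d) → ZdEdge d → ℝ} (hlip : ∀ X, IsLipBound suFrobDist (W X) (lip X))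
    (hlips : ∀ e, ∑ X ∈ (supp {e}).filter (fun X => e ∈ X), lip X e ≤ ℓs) :
    IsKRContraction (perturbedYM (d := d) (fundamentalRep (Fin N)) (N * β) W supp) suFrobDist
      (perturbedNbr supp) fun e y =>
        K * exp a * (1 + 2 * Real.sqrt N * ℓs) * |β| * linkInfluence e y +
          Real.sqrt N * ∑ X ∈ (supp {e}).filter (fun X => e ∈ X), lip X y := by
  classical
  haveI : SecondCountableTopology (Matrix (Fin N) (Fin N) ℂ) :=
    inferInstanceAs (SecondCountableTopology (Fin N → Fin N → ℂ))
  haveI : SecondCountableTopology (Matrix.specialUnitaryGroup (Fin N) ℂ) :=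
    Topology.IsEmbedding.subtypeVal.secondCountableTopology
  have hWm : ∀ X, Measurable (W X) := fun X => (hW X).2
  refine isKRContraction_perturbedYM (fundamentalRep (Fin N)) (continuous_fundamentalRep (Fin N)) (N * β)
    hW supp (fun e y => add_nonneg (by positivity)
      (mul_nonneg (Real.sqrt_nonneg _) (Finset.sum_nonneg fun X _ => (hlip X).nonneg y))) ?_
  intro e y hy ω η hωη φ L hφm hφb hL hφL
  have hye : y ≠ e := ne_of_mem_of_not_mem hy (not_mem_perturbedNbr supp e)
  rw [siteLaw_perturbedYM_thooft β hWm supp e ω, siteLaw_perturbedYM_thooft β hWm supp e η]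
  -- the one-link perturbations and their loads
  set ℓ : ℝ := ∑ X ∈ (supp {e}).filter (fun X => e ∈ X), lip X y with hℓ
  have hℓ0 : 0 ≤ ℓ := Finset.sum_nonneg fun X _ => (hlip X).nonneg y
  have hr0 : 0 ≤ suFrobDist (ω y) (η y) := suFrobDist_nonneg _ _
  set V : LGConfig d (Matrix.specialUnitaryGroup (Fin N) ℂ) → Matrix.specialUnitaryGroup (Fin N) ℂ → ℝ :=
    fun ζ g => hamiltonianIn W supp {e} (Function.update ζ e g) with hV
  have hVm : ∀ ζ, Measurable (V ζ) := fun ζ =>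
    (measurable_hamiltonianIn hWm supp {e}).comp (measurable_update ζ)
  have hoscV : ∀ ζ (g g' : Matrix.specialUnitaryGroup (Fin N) ℂ), V ζ g - V ζ g' ≤ a := fun ζ g g' => by
    have h := (hamiltonianIn_singleton_update_osc (supp := supp) hosc e ζ g g').trans (add_le_add_right (hosca e) _)
    simp only [hV]; linarith
  have hlipV : ∀ g g', |V ω g - V ω g'| ≤ ℓs * suFrobDist g g' := fun g g' =>
    (abs_hamiltonianIn_singleton_update_sub_update_le (supp := supp) hlip e ω g g').trans
      (mul_le_mul_of_nonneg_right (hlips e) (suFrobDist_nonneg _ _))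
  have hcross : ∀ g, |V ω g - V η g| ≤ ℓ * suFrobDist (ω y) (η y) := fun g =>
    abs_hamiltonianIn_singleton_update_sub_le (supp := supp) hlip hye hωη g
  -- the staple fields lie in the ball and differ by `≤ |β| n(e,y) ‖ω_y − η_y‖_F`
  have hBω : matrixOpNorm (stapleField β e ω) ≤ b := (matrixOpNorm_stapleField_le hd hN β e ω).trans hb
  have hBη : matrixOpNorm (stapleField β e η) ≤ b := (matrixOpNorm_stapleField_le hd hN β e η).trans hb
  have hΔB : frobNorm (stapleField β e ω - stapleField β e η) ≤
      |β| * linkInfluence e y * suFrobDist (ω y) (η y) := frobNorm_stapleField_sub_le β e y hωη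
  -- the tilt `N Re tr(g B) − V g` is the Wilson law re-weighted by `−V`
  have hsplit : ∀ ζ : LGConfig d (Matrix.specialUnitaryGroup (Fin N) ℂ),
      (haarProbability (Matrix.specialUnitaryGroup (Fin N) ℂ)).tilted
          (fun g => (N : ℝ) * ((g : Matrix (Fin N) (Fin N) ℂ) * stapleField β e ζ).trace.re -
            hamiltonianIn W supp {e} (Function.update ζ e g)) =
        ((haarProbability (Matrix.specialUnitaryGroup (Fin N) ℂ)).tilted
          fun g => (N : ℝ) * ((g : Matrix (Fin N) (Fin N) ℂ) * stapleField β e ζ).trace.re).tilted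
          fun g => -V ζ g := by
    intro ζ
    rw [← su_tilted_linear_add (stapleField β e ζ) (fun g => -V ζ g)]
    rfl
  rw [hsplit ω, hsplit η]
  -- the robust one-link lemma (both legs)
  have key := su_oneLink_robust_influence (N := N) (δ := a) (ℓ := ℓs) (s := ℓ * suFrobDist (ω y) (η y)) hℓs hmod
    (stapleField β e ω) (stapleField β e η) hBω hBη (V ω) (V η) (hVm ω) (hVm η)
    (su_exists_abs_le_of_osc (hoscV η)) (hoscV ω) hlipV hcross φ L hφm hφb hL hφL
  refine key.trans ?_
  have hT : 0 ≤ K * exp a * (1 + 2 * Real.sqrt N * ℓs) := by positivity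
  calc (K * exp a * (1 + 2 * Real.sqrt N * ℓs) * frobNorm (stapleField β e ω - stapleField β e η) +
          Real.sqrt N * (ℓ * suFrobDist (ω y) (η y))) * L
      ≤ (K * exp a * (1 + 2 * Real.sqrt N * ℓs) * (|β| * linkInfluence e y * suFrobDist (ω y) (η y)) +
          Real.sqrt N * (ℓ * suFrobDist (ω y) (η y))) * L := by
        gcongr
    _ = (K * exp a * (1 + 2 * Real.sqrt N * ℓs) * |β| * linkInfluence e y + Real.sqrt N * ℓ) * L *
          suFrobDist (ω y) (η y) := by ring

/-- **The row sums of the KR-door coefficients**: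
`∑_{y ∈ perturbedNbr supp e} C(e, y) ≤ ρ_KR := 6(d−1)|β| K e^{a}(1 + 2√N ℓ_s) + √N Λ` from `∑_y n(e, y) ≤ 6(d−1)` and the
cross-Lipschitz load `∑_y ℓ(e, y) ≤ Λ` — numbers `(β, K, a, ℓ_s, Λ)` only. [folklore] -/
theorem sum_perturbedNbr_coeffKR_le (hd : 1 ≤ d) {β K a ℓs Λ : ℝ} (hK : 0 ≤ K) (hℓs : 0 ≤ ℓs)
    {supp : Finset (ZdEdge d) → Finset (Finset (ZdEdge d))} {lip : Finset (ZdEdge d) → ZdEdge d → ℝ}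
    (hΛ : ∀ e, ∑ y ∈ perturbedNbr supp e, ∑ X ∈ (supp {e}).filter (fun X => e ∈ X), lip X y ≤ Λ)
    (e : ZdEdge d) :
    ∑ y ∈ perturbedNbr supp e,
        (K * exp a * (1 + 2 * Real.sqrt N * ℓs) * |β| * linkInfluence e y +
          Real.sqrt N * ∑ X ∈ (supp {e}).filter (fun X => e ∈ X), lip X y) ≤
      6 * ((d : ℝ) - 1) * |β| * (K * exp a * (1 + 2 * Real.sqrt N * ℓs)) + Real.sqrt N * Λ := by
  classical
  rw [Finset.sum_add_distrib, ← Finset.mul_sum, ← Finset.mul_sum]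
  have hn : ∑ y ∈ perturbedNbr supp e, (linkInfluence e y : ℝ) ≤ 6 * ((d : ℝ) - 1) := by
    have h := sum_linkInfluence_le_of_subset e (perturbedNbr supp e)
    calc ∑ y ∈ perturbedNbr supp e, (linkInfluence e y : ℝ)
        = ((∑ y ∈ perturbedNbr supp e, linkInfluence e y : ℕ) : ℝ) := by push_cast; rfl
      _ ≤ ((6 * (d - 1) : ℕ) : ℝ) := by exact_mod_cast h
      _ = 6 * ((d : ℝ) - 1) := by push_cast [Nat.cast_sub hd]; ring
  have h1 : K * exp a * (1 + 2 * Real.sqrt N * ℓs) * |β| * ∑ y ∈ perturbedNbr supp e, (linkInfluence e y : ℝ) ≤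
      K * exp a * (1 + 2 * Real.sqrt N * ℓs) * |β| * (6 * ((d : ℝ) - 1)) :=
    mul_le_mul_of_nonneg_left hn (by positivity)
  have h2 : Real.sqrt N * ∑ y ∈ perturbedNbr supp e, ∑ X ∈ (supp {e}).filter (fun X => e ∈ X), lip X y ≤
      Real.sqrt N * Λ := mul_le_mul_of_nonneg_left (hΛ e) (Real.sqrt_nonneg _)
  calc _ ≤ K * exp a * (1 + 2 * Real.sqrt N * ℓs) * |β| * (6 * ((d : ℝ) - 1)) + Real.sqrt N * Λ := add_le_add h1 h2
    _ = _ := by ring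

/-- **(i) DLR UNIQUENESS on the ball through the KR door.**  Under the hypotheses of
`isKRContraction_perturbedYM_of_oneLinkKRModulus`, with `W` bounded termwise and supported by `supp`, cross-Lipschitz load
`≤ Λ`, and `ρ_KR = 6(d−1)|β| K e^{a}(1 + 2√N ℓ_s) + √N Λ < 1`: the perturbed `SU(N)` theory at bare coupling `N β` has AT MOST
ONE DLR state (`subsingleton_gibbsMeasures_of_isKRContraction`; existence is rb-p1's `PerturbedExistence`). [folklore] -/
theorem subsingleton_perturbedGibbsMeasures_of_oneLinkKRModulus (hd : 1 ≤ d) (hN : 1 ≤ N) {β b K a ℓs Λ : ℝ}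
    (hK : 0 ≤ K) (hℓs : 0 ≤ ℓs) (hb : |β| * (2 * ((d : ℝ) - 1)) ≤ b) (hmod : OneLinkKRModulus N b K)
    {W : Potential (ZdEdge d) (Matrix.specialUnitaryGroup (Fin N) ℂ)} (hW : W.IsAdapted)
    (hWb : ∀ X, ∃ C, ∀ U, |W X U| ≤ C)
    {supp : Finset (ZdEdge d) → Finset (Finset (ZdEdge d))} (hsupp : W.IsSupportedBy supp)
    {osc : Finset (ZdEdge d) → ZdEdge d → ℝ} (hosc : ∀ X, Dobrushin.IsOscBound (W X) (osc X))
    (hosca : ∀ e, ∑ X ∈ (supp {e}).filter (fun X => e ∈ X), osc X e ≤ a)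
    {lip : Finset (ZdEdge d) → ZdEdge d → ℝ} (hlip : ∀ X, IsLipBound suFrobDist (W X) (lip X))
    (hlips : ∀ e, ∑ X ∈ (supp {e}).filter (fun X => e ∈ X), lip X e ≤ ℓs)
    (hΛ : ∀ e, ∑ y ∈ perturbedNbr supp e, ∑ X ∈ (supp {e}).filter (fun X => e ∈ X), lip X y ≤ Λ)
    (hρ : 6 * ((d : ℝ) - 1) * |β| * (K * exp a * (1 + 2 * Real.sqrt N * ℓs)) + Real.sqrt N * Λ < 1) :
    (perturbedGibbsMeasures (d := d) (fundamentalRep (Fin N)) (N * β) W supp).Subsingleton := by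
  classical
  haveI : SecondCountableTopology (Matrix (Fin N) (Fin N) ℂ) :=
    inferInstanceAs (SecondCountableTopology (Fin N → Fin N → ℂ))
  haveI : SecondCountableTopology (Matrix.specialUnitaryGroup (Fin N) ℂ) :=
    Topology.IsEmbedding.subtypeVal.secondCountableTopology
  have hγ : IsSpecification (perturbedYM (d := d) (fundamentalRep (Fin N)) (N * β) W supp) :=
    isSpecification_perturbedYM _ (continuous_fundamentalRep (Fin N)) _ hW hWb hsupp
  have hKR := isKRContraction_perturbedYM_of_oneLinkKRModulus hd hN hK hℓs hb hmod hW (supp := supp) hosc hosca hlip hlips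
  have hrow := sum_perturbedNbr_coeffKR_le (N := N) hd (β := β) (a := a) hK hℓs hΛ
  have hρ0 : 0 ≤ 6 * ((d : ℝ) - 1) * |β| * (K * exp a * (1 + 2 * Real.sqrt N * ℓs)) + Real.sqrt N * Λ := by
    have hd' : (1 : ℝ) ≤ d := by exact_mod_cast hd
    have hΛ0 : 0 ≤ Λ := by
      have hd0 : 0 < d := hd
      let e₀ : ZdEdge d := (0, ⟨0, hd0⟩)
      exact (Finset.sum_nonneg fun y _ => Finset.sum_nonneg fun X _ => (hlip X).nonneg y).trans (hΛ e₀)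
    have : 0 ≤ (d : ℝ) - 1 := by linarith
    positivity
  exact subsingleton_gibbsMeasures_of_isKRContraction hγ hKR (fun _ _ => suFrobDist_nonneg _ _)
    suFrobDist_le suEntries measurableSpace_specialUnitaryGroup_eq_comap zero_le_one
    (fun a b => by rw [one_mul]; exact dist_suEntries_le_suFrobDist a b) hρ0 hρ hrow

end Door

end Summit.Ventures.YMGap.RobustBall
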